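import Mathlib
import HarnessLib
import Literature.Combinatorics.Additive.StepBeyondKempermanReduction

/-!
# Grynkiewicz 2009, §6 Claims 2–4: Theorem 4.1 reduces to its core case

[cite: Grynkiewicz2009, §6 Claims 2–4 (proof of Thm 4.1)] [tag: critical-pair] [tag: inverse-theorem]

Topic `Literature/Combinatorics/Additive`.  Cell `mm-stpp` (D-0046), seat `mm-stpp-lit` (gen 23); the
port of D. J. Grynkiewicz, *A step beyond Kemperman's structure theorem*, Mathematika **55** (2009)
67–114 continued.  The opening of the proof of Theorem 4.1 (§6, print pp. 23–24) reduces the theorem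
(first part: `A + B` aperiodic) to its CORE CASE: «We may assume w.l.o.g. that `0 ∈ A ∩ B`.  If either
`A` or `B` is extendible, then (17) immediately follows. … Claim 2: `d⊆(A + B, 𝒫) ≥ 2`. … Claim 3:
`|A|, |B| ≥ 3`. … Claim 4: It suffices to prove Theorem 4.1 in the case both `A` and `B` are
non-quasi-periodic sets with `⟨A⟩ = ⟨B⟩ = G`. … Thus it follows in view of Lemma 5.2 — which we can
apply to `(A, B)` by Claims 1 and 3 — that w.l.o.g. we may also assume `⟨A⟩ = ⟨B⟩ = G` (recall
`0 ∈ A ∩ B`).»  The individual steps are in the tree (`seventeen_of_insert_add_eq`,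
`seventeen_of_addStab_insert_ne` = Claim 2, `isGrynkiewiczDecomp_top_of_card_eq_two` = Claim 3,
`conclusion_of_forall_not_isQuasiPeriodic` = Claim 4 first half, Lemma 5.2
`closure_eq_closure_of_not_isQuasiPeriodic`, the translation lemmas `seventeen_of_vadd`,
`exists_isGrynkiewiczDecomp_of_vadd`); this file supplies the passage to the subgroup `⟨A⟩ = ⟨B⟩` —
the TRANSPORT of the conclusion of Theorem 4.1 from a subgroup type `↥H'` to `G` (types (V)–(VIII),
dual pairs, the decompositions, (17)), in the `toSub` convention of `KempermanStructureTheorem.lean` /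
`KempermanDecompositionExistence.lean` (where `IsKempermanDecompI.of_toSub` is the model) — and
assembles the reduction.

MAIN RESULTS (0 definitions, 0 named facts; everything PROVED).
* Transport `↥H' → G`: `IsTypeV.of_toSub`, `IsTypeVI.of_toSub`, `IsDualPair.of_toSub`,
  `IsTypeVII.of_toSub`, `IsTypeVIII.of_toSub`, `IsGrynkiewiczDecomp.of_toSub`,
  `Grynkiewicz2009.seventeen_of_toSub`, `Grynkiewicz2009.conclusion_of_toSub`; and `G → ↥H'` for the
  hypotheses: `isNonExtendible_toSub`, `addStab_toSub_eq_singleton`, `forall_card_sdiff_toSub`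
  (`d⊆(A + B, 𝒫) ≥ k`), `closure_toSub_eq_top`.
* `Grynkiewicz2009.conclusion_of_core₀` — Claims 2, 3 and «w.l.o.g. `0 ∈ A ∩ B`» on top of Claim 4's
  first half: the conclusion of Theorem 4.1 for all pairs in `G` with `0 ∈ A ∩ B`, `|A|, |B| ≥ 3`,
  `|A + B| = |A| + |B|`, `A + B` aperiodic, `d⊆(A + B, 𝒫) ≥ 2`, `(A, B)` non-extendible, `A`, `B` not
  quasi-periodic implies it for all nonempty pairs with `|A + B| = |A| + |B|` and `A + B` aperiodic.
* `Grynkiewicz2009.conclusion_of_core` — **THEOREM 4.1 (FIRST PART) REDUCES TO ITS CORE CASE**: if for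
  every subgroup `G' ≤ G` the conclusion holds for all pairs `A, B ⊆ G'` (as finsets of `↥G'`) with the
  above standing assumptions AND `⟨A⟩ = ⟨B⟩ = G'`, then it holds for every pair of nonempty finite
  `A, B ⊆ G` with `|A + B| = |A| + |B|` and `A + B` aperiodic.
The rest of §6 (Claim 5 onwards) proves the core case for `G'` finite; the infinite case is the
print's closing Freiman-isomorphism argument.

## References
* D. J. Grynkiewicz, *A step beyond Kemperman's structure theorem*, Mathematika 55 (2009) 67–114,
  doi:10.1112/S0025579300000966, §6 (proof of Thm 4.1, Claims 2–4, pp. 23–24), Lemma 5.2 (p. 15)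
  [cite: Grynkiewicz2009, Thm 4.1 (proof, Claims 2–4)] — held `paper:doi-10-1112-s0025579300000966`,
  p0023–p0024 read 2026-08-29.
-/

namespace Literature.Combinatorics.Additive

open Finset
open scoped Pointwise

universe u

variable {G : Type u} [AddCommGroup G] [DecidableEq G]

section Transport

variable {H' : AddSubgroup G}

/-! ### Small transport lemmas for the subgroup type `↥H'` -/

/-- `toSub` commutes with `insert` of an element of `H'`. [cite: Grynkiewicz2009, §6 Claim 4] -/
theorem toSub_insert {X : Finset G} (α : ↥H') :
    toSub H' (insert (α : G) X) = insert α (toSub H' X) := by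
  ext z
  rw [mem_toSub, mem_insert, mem_insert, mem_toSub, Subtype.ext_iff]

omit [DecidableEq G] in
/-- Inserting an element of `H'` keeps a subset of `H'` inside `H'`. [cite: Grynkiewicz2009, §6 Claim 4] -/
theorem coe_insert_subset [DecidableEq G] {X : Finset G} (hX : (X : Set G) ⊆ H') (α : ↥H') :
    ((insert (α : G) X : Finset G) : Set G) ⊆ H' := by
  rw [coe_insert]; exact Set.insert_subset α.2 hX

/-- Negation inside the subgroup type, seen in `G`. [cite: Grynkiewicz2009, §2 (dual pair)] -/
theorem image_val_neg [DecidableEq ↥H'] (P : Finset ↥H') :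
    (-P).image Subtype.val = -(P.image Subtype.val) := by
  ext y
  rw [mem_image, mem_neg', mem_image]
  constructor
  · rintro ⟨x, hx, rfl⟩
    rw [mem_neg'] at hx
    exact ⟨-x, hx, by simp⟩
  · rintro ⟨x, hx, hxy⟩
    refine ⟨-x, by rw [mem_neg', neg_neg]; exact hx, ?_⟩
    simp [hxy]

/-- Sums inside the subgroup type, seen in `G`. [cite: Grynkiewicz2009, §6 Claim 4] -/
theorem image_val_add [DecidableEq ↥H'] (S T : Finset ↥H') :
    (S + T).image Subtype.val = S.image Subtype.val + T.image Subtype.val := by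
  have := image_add (s := S) (t := T) H'.subtype
  simpa only [AddSubgroup.coe_subtype] using this

/-! ### Non-extendibility, aperiodicity, `d⊆(·, 𝒫)`, generation: `G ↔ ↥H'` -/

/-- Non-extendibility descends from `↥H'` to `G` (for `Y ≠ ∅`: an element outside `H'` added to `X`
creates a sum outside `H'`). [cite: Grynkiewicz2009, §2 (display (2)); §6 Claim 4] -/
theorem isNonExtendible_of_toSub {X Y : Finset G} (hX : (X : Set G) ⊆ H') (hY : (Y : Set G) ⊆ H')
    (hYne : Y.Nonempty) (h : IsNonExtendible (toSub H' X) (toSub H' Y)) : IsNonExtendible X Y := by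
  classical
  intro a ha heq
  by_cases haH : a ∈ H'
  · have ha' : (⟨a, haH⟩ : ↥H') ∉ toSub H' X := fun h' => ha (mem_toSub.1 h')
    apply h _ ha'
    have hαX := coe_insert_subset hX ⟨a, haH⟩
    rw [← toSub_insert, ← toSub_add hαX hY, ← toSub_add hX hY]
    exact congrArg (toSub H') heq
  · obtain ⟨y, hy⟩ := hYne
    have hay : a + y ∈ X + Y := by rw [← heq]; exact add_mem_add (mem_insert_self _ _) hy
    apply haH
    have := H'.sub_mem (coe_add_subset hX hY (mem_coe.2 hay)) (hY (mem_coe.2 hy))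
    rwa [add_sub_cancel_right] at this

/-- Non-extendibility lifts from `G` to `↥H'`. [cite: Grynkiewicz2009, §2 (display (2)); §6 Claim 4] -/
theorem isNonExtendible_toSub {X Y : Finset G} (hX : (X : Set G) ⊆ H') (hY : (Y : Set G) ⊆ H')
    (h : IsNonExtendible X Y) : IsNonExtendible (toSub H' X) (toSub H' Y) := by
  classical
  intro a ha heq
  have ha' : (a : G) ∉ X := fun h' => ha (mem_toSub.2 h')
  apply h _ ha'
  have hαX := coe_insert_subset hX a
  have := congrArg (Finset.image (Subtype.val : ↥H' → G)) heq
  rwa [← toSub_insert, ← toSub_add hαX hY, ← toSub_add hX hY,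
    image_val_toSub (coe_add_subset hαX hY), image_val_toSub (coe_add_subset hX hY)] at this

/-- Aperiodicity (`H(Z) = {0}`) lifts from `G` to `↥H'`. [cite: Grynkiewicz2009, §6 Claim 4] -/
theorem addStab_toSub_eq_singleton {Z : Finset G} (hZ : (Z : Set G) ⊆ H') (hne : Z.Nonempty)
    (h : Z.addStab = {0}) : (toSub H' Z).addStab = {0} := by
  classical
  by_contra hne'
  have hp : IsPeriodic (toSub H' Z) := (isPeriodic_iff_addStab_ne (toSub_nonempty hZ hne)).2 hne'
  exact (isPeriodic_iff_addStab_ne hne).1 (isPeriodic_of_toSub hZ hp) h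

/-- `d⊆(Z, 𝒫) ≥ k` lifts from `G` to `↥H'`: a periodic superset of `Z` inside `↥H'` is, seen in `G`, a
periodic superset with the same number of extra elements. [cite: Grynkiewicz2009, §6 Claims 2 and 4] -/
theorem forall_card_sdiff_toSub {Z : Finset G} (hZ : (Z : Set G) ⊆ H') (hne : Z.Nonempty) {k : ℕ}
    (h : ∀ P : Finset G, Z ⊆ P → P.addStab ≠ {0} → k ≤ #(P \ Z)) :
    ∀ P : Finset ↥H', toSub H' Z ⊆ P → P.addStab ≠ {0} → k ≤ #(P \ toSub H' Z) := by
  classical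
  intro P hZP hP
  have hPne : P.Nonempty := by
    obtain ⟨z, hz⟩ := hne
    exact ⟨⟨z, hZ (mem_coe.2 hz)⟩, hZP (mem_toSub.2 hz)⟩
  have hP' : ((P.image Subtype.val : Finset G) : Set G) ⊆ H' := coe_image_val_subset P
  have hZP' : Z ⊆ P.image Subtype.val := by
    rw [← image_val_toSub hZ]; exact image_subset_image hZP
  have hP'per : (P.image Subtype.val).addStab ≠ {0} := by
    have hp : IsPeriodic P := (isPeriodic_iff_addStab_ne hPne).2 hP
    have : IsPeriodic (P.image Subtype.val) :=
      isPeriodic_of_toSub hP' (by rw [toSub_image_val]; exact hp)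
    exact (isPeriodic_iff_addStab_ne (hPne.image _)).1 this
  have := h _ hZP' hP'per
  rwa [← image_val_toSub hZ, ← image_sdiff _ _ Subtype.val_injective,
    card_image_of_injective _ Subtype.val_injective] at this

omit [DecidableEq G] in
/-- `⟨A⟩ = G'` in `G` means that `A`, as a subset of `↥G'`, generates `↥G'`.
[cite: Grynkiewicz2009, §6 Claim 4 («w.l.o.g. ⟨A⟩ = ⟨B⟩ = G»)] -/
theorem closure_toSub_eq_top {X : Finset G} (h : AddSubgroup.closure (X : Set G) = H') :
    AddSubgroup.closure ((toSub H' X : Finset ↥H') : Set ↥H') = ⊤ := by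
  subst h
  have : ((toSub (AddSubgroup.closure (X : Set G)) X : Finset ↥(AddSubgroup.closure (X : Set G))) :
      Set ↥(AddSubgroup.closure (X : Set G))) = Subtype.val ⁻¹' (X : Set G) := by
    ext z; rw [mem_coe, mem_toSub, Set.mem_preimage, mem_coe]
  rw [this]
  exact AddSubgroup.closure_closure_coe_preimage

/-! ### Types (V)–(VIII), dual pairs and the decompositions descend from `↥H'` to `G` -/

/-- Type (V) descends from `↥H'` to `G`. [cite: Grynkiewicz2009, §4 (type (V)); §6 Claim 4] -/
theorem IsTypeV.of_toSub {X Y : Finset G} (hX : (X : Set G) ⊆ H') (hY : (Y : Set G) ⊆ H')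
    (h : IsTypeV (toSub H' X) (toSub H' Y)) : IsTypeV X Y := by
  obtain ⟨h1, h2⟩ := h
  rw [card_toSub hX, card_toSub hY] at h1
  rw [← toSub_add hX hY, card_toSub (coe_add_subset hX hY), card_toSub hX, card_toSub hY] at h2
  exact ⟨h1, h2⟩

/-- Type (VI) descends from `↥H'` to `G`. [cite: Grynkiewicz2009, §4 (type (VI)); §6 Claim 4] -/
theorem IsTypeVI.of_toSub {X Y : Finset G} (hX : (X : Set G) ⊆ H') (hY : (Y : Set G) ⊆ H')
    (h : IsTypeVI (toSub H' X) (toSub H' Y)) : IsTypeVI X Y := by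
  classical
  obtain ⟨h1, h2, ⟨x, hx⟩, h3⟩ := h
  rw [card_toSub hX] at h1
  rw [card_toSub hY] at h2
  rw [← toSub_add hX hY, card_toSub (coe_add_subset hX hY), card_toSub hX, card_toSub hY] at h3
  refine ⟨h1, h2, ⟨(x : G), ?_⟩, h3⟩
  rw [← image_val_toSub hX, hx, image_val_vadd, image_val_toSub hY]

/-- Dual pairs descend from `↥H'` to `G` (the subgroup `L ≤ ↥H'` pushed forward to `G`).
[cite: Grynkiewicz2009, §2 (dual pair, p. 7); §6 Claim 4] -/
theorem IsDualPair.of_toSub {L : AddSubgroup ↥H'} {X Y X' Y' : Finset G}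
    (hX : (X : Set G) ⊆ H') (hY : (Y : Set G) ⊆ H') (hX' : (X' : Set G) ⊆ H')
    (hY' : (Y' : Set G) ⊆ H') (h : IsDualPair L (toSub H' X) (toSub H' Y) (toSub H' X') (toSub H' Y')) :
    IsDualPair (L.map H'.subtype) X Y X' Y' := by
  classical
  have memX : ∀ {x}, x ∈ X → x ∈ H' := fun hx => hX (mem_coe.2 hx)
  have memY : ∀ {y}, y ∈ Y → y ∈ H' := fun hy => hY (mem_coe.2 hy)
  obtain ⟨a, ha, b, hb, hXa, hYb, hne1, hne2, halt⟩ := h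
  have hXne : X.Nonempty := ⟨a, mem_toSub.1 ha⟩
  have hYne : Y.Nonempty := ⟨b, mem_toSub.1 hb⟩
  have cosX : ∀ x ∈ X, x - (a : G) ∈ L.map H'.subtype := fun x hx => by
    have := hXa ⟨x, memX hx⟩ (mem_toSub.2 hx)
    have e : x - (a : G) = ((⟨x, memX hx⟩ - a : ↥H') : G) := rfl
    rw [e]; exact mem_map_subtype_iff.2 this
  have cosY : ∀ y ∈ Y, y - (b : G) ∈ L.map H'.subtype := fun y hy => by
    have := hYb ⟨y, memY hy⟩ (mem_toSub.2 hy)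
    have e : y - (b : G) = ((⟨y, memY hy⟩ - b : ↥H') : G) := rfl
    rw [e]; exact mem_map_subtype_iff.2 this
  -- the membership description of the translated coset complement, in either orientation
  have key : ∀ (Z' : Finset G) (g' : ↥H'), ((Z' : Set G) ⊆ H') →
      (∀ z : ↥H', z ∈ toSub H' Z' ↔ (z - g') - (a + b) ∈ L ∧ z - g' ∉ toSub H' X + toSub H' Y) →
      ∀ z : G, z ∈ Z' ↔ (z - g') - ((a : G) + b) ∈ L.map H'.subtype ∧ z - g' ∉ X + Y := by
    intro Z' g' hZ' hiff z
    by_cases hz : z ∈ H'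
    · have hz' := hiff ⟨z, hz⟩
      rw [mem_toSub, ← toSub_add hX hY, mem_toSub] at hz'
      have e : z - (g' : G) - ((a : G) + b) = ((⟨z, hz⟩ - g' - (a + b) : ↥H') : G) := rfl
      rw [e, mem_map_subtype_iff]
      exact hz'
    · constructor
      · intro hzZ; exact absurd (hZ' (mem_coe.2 hzZ)) hz
      · rintro ⟨h1, -⟩
        exfalso; apply hz
        have hm := mem_of_mem_map_subtype h1
        have e : z = (z - g' - ((a : G) + b)) + ((a : G) + b) + g' := by abel
        rw [e]
        exact H'.add_mem (H'.add_mem hm (H'.add_mem a.2 b.2)) g'.2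
  refine ⟨a, mem_toSub.1 ha, b, mem_toSub.1 hb, cosX, cosY,
    isNonExtendible_of_toSub hX hY hYne hne1, isNonExtendible_of_toSub hY hX hXne hne2, ?_⟩
  rcases halt with ⟨g, g', hX'eq, hiff⟩ | ⟨g, g', hY'eq, hiff⟩
  · refine Or.inl ⟨g, g', ?_, key Y' g' hY' hiff⟩
    rw [← image_val_toSub hX', hX'eq, image_val_vadd, image_val_neg, image_val_toSub hX]
  · refine Or.inr ⟨g, g', ?_, key X' g' hX' hiff⟩
    rw [← image_val_toSub hY', hY'eq, image_val_vadd, image_val_neg, image_val_toSub hY]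

/-- Type (VII) descends from `↥H'` to `G`. [cite: Grynkiewicz2009, §4 (type (VII)); §6 Claim 4] -/
theorem IsTypeVII.of_toSub {X Y : Finset G} (hX : (X : Set G) ⊆ H') (hY : (Y : Set G) ⊆ H')
    (h : IsTypeVII (toSub H' X) (toSub H' Y)) : IsTypeVII X Y := by
  classical
  obtain ⟨K, A', B', hKf, hVI, hdual⟩ := h
  have hA' : ((A'.image Subtype.val : Finset G) : Set G) ⊆ H' := coe_image_val_subset A'
  have hB' : ((B'.image Subtype.val : Finset G) : Set G) ⊆ H' := coe_image_val_subset B'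
  refine ⟨K.map H'.subtype, A'.image Subtype.val, B'.image Subtype.val, ?_, ?_, ?_⟩
  · rw [AddSubgroup.coe_map]; exact hKf.image _
  · rw [← toSub_image_val A', ← toSub_image_val B'] at hVI
    exact IsTypeVI.of_toSub hA' hB' hVI
  · rw [← toSub_image_val A', ← toSub_image_val B'] at hdual
    exact IsDualPair.of_toSub hA' hB' hX hY hdual

/-- Type (VIII) descends from `↥H'` to `G` (the Klein four-group `K ≤ ↥H'` and its carrier pushed
forward; progressions, translates, cardinalities are preserved by the inclusion).
[cite: Grynkiewicz2009, §4 (type (VIII)); §6 Claim 4] -/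
theorem IsTypeVIII.of_toSub {X Y : Finset G} (hX : (X : Set G) ⊆ H') (hY : (Y : Set G) ⊆ H')
    (h : IsTypeVIII (toSub H' X) (toSub H' Y)) : IsTypeVIII X Y := by
  classical
  obtain ⟨hXap, hYap, hXYap, K, Kf, hKf, hK4, hK2, a, b, d, m, n, ha, hb, hm, hn, hXK, hYK, hcard,
    hXc, hYc, hea1, hea2, heb1, heb2⟩ := h
  have hXne : X.Nonempty := ⟨a, mem_toSub.1 ha⟩
  have hYne : Y.Nonempty := ⟨b, mem_toSub.1 hb⟩
  have hKf' : ∀ g, g ∈ Kf.image Subtype.val ↔ g ∈ K.map H'.subtype := by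
    intro g
    rw [mem_image]
    constructor
    · rintro ⟨k, hk, rfl⟩; exact mem_map_subtype_iff.2 ((hKf k).1 hk)
    · intro hg
      obtain ⟨k, hk, rfl⟩ := AddSubgroup.mem_map.1 hg
      exact ⟨k, (hKf k).2 hk, rfl⟩
  have hinj : Function.Injective (Subtype.val : ↥H' → G) := Subtype.val_injective
  refine ⟨fun hp => hXap (isPeriodic_toSub hX hXne hp), fun hp => hYap (isPeriodic_toSub hY hYne hp),
    fun hp => hXYap (by
      rw [← toSub_add hX hY]
      exact isPeriodic_toSub (coe_add_subset hX hY) (hXne.add hYne) hp),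
    K.map H'.subtype, Kf.image Subtype.val, hKf', ?_, ?_, (a : G), (b : G), (d : G), m, n,
    mem_toSub.1 ha, mem_toSub.1 hb, hm, hn, ?_, ?_, ?_, ?_, ?_, ?_, ?_, ?_, ?_⟩
  · rw [card_image_of_injective _ hinj]; exact hK4
  · intro k hk
    obtain ⟨k', hk', rfl⟩ := AddSubgroup.mem_map.1 hk
    have := congrArg (Subtype.val : ↥H' → G) (hK2 k' hk')
    simpa using this
  · have := congrArg (Finset.image (Subtype.val : ↥H' → G)) hXK
    simpa only [image_val_add, image_val_toSub hX, image_val_apFinset] using this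
  · have := congrArg (Finset.image (Subtype.val : ↥H' → G)) hYK
    simpa only [image_val_add, image_val_toSub hY, image_val_apFinset] using this
  · rw [← card_image_of_injective _ hinj, image_val_add, image_val_apFinset] at hcard
    push_cast at hcard
    exact hcard
  · rw [← card_image_of_injective (toSub H' X + Kf) hinj, image_val_add, image_val_toSub hX,
      card_toSub hX] at hXc
    exact hXc
  · rw [← card_image_of_injective (toSub H' Y + Kf) hinj, image_val_add, image_val_toSub hY,
      card_toSub hY] at hYc
    exact hYc
  · rw [← card_image_of_injective _ hinj, image_sdiff _ _ hinj, image_val_vadd,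
      image_val_toSub hX] at hea1
    exact hea1
  · rw [← card_image_of_injective _ hinj, image_sdiff _ _ hinj, image_val_vadd,
      image_val_toSub hX] at hea2
    push_cast at hea2
    exact hea2
  · rw [← card_image_of_injective _ hinj, image_sdiff _ _ hinj, image_val_vadd,
      image_val_toSub hY] at heb1
    exact heb1
  · rw [← card_image_of_injective _ hinj, image_sdiff _ _ hinj, image_val_vadd,
      image_val_toSub hY] at heb2
    push_cast at heb2
    exact heb2

/-- The decompositions of Theorem 4.1 descend from `↥H'` to `G` (cf. `IsKempermanDecompI.of_toSub`).
[cite: Grynkiewicz2009, Thm 4.1; §6 Claim 4] -/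
theorem IsGrynkiewiczDecomp.of_toSub {L : AddSubgroup ↥H'} {X Y : Finset G} {X₁ X₀ Y₁ Y₀ : Finset ↥H'}
    (hX : (X : Set G) ⊆ H') (hY : (Y : Set G) ⊆ H')
    (h : IsGrynkiewiczDecomp L (toSub H' X) (toSub H' Y) X₁ X₀ Y₁ Y₀) :
    IsGrynkiewiczDecomp (L.map H'.subtype) X Y (X₁.image Subtype.val) (X₀.image Subtype.val)
      (Y₁.image Subtype.val) (Y₀.image Subtype.val) := by
  classical
  have memX : ∀ {x}, x ∈ X → x ∈ H' := fun hx => hX (mem_coe.2 hx)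
  have memY : ∀ {y}, y ∈ Y → y ∈ H' := fun hy => hY (mem_coe.2 hy)
  have hX₀ : ((X₀.image Subtype.val : Finset G) : Set G) ⊆ H' := coe_image_val_subset X₀
  have hY₀ : ((Y₀.image Subtype.val : Finset G) : Set G) ⊆ H' := coe_image_val_subset Y₀
  refine
    { decomp_left := h.decomp_left.of_toSub hX
      decomp_right := h.decomp_right.of_toSub hY
      left_nonempty := h.left_nonempty.image _
      right_nonempty := h.right_nonempty.image _
      quot_unique := ?_
      cosetCount_add := ?_
      bottom := ?_ }
  · intro a ha b hb a₀ ha₀ b₀ hb₀ hq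
    obtain ⟨a₀', ha₀', rfl⟩ := mem_image.1 ha₀
    obtain ⟨b₀', hb₀', rfl⟩ := mem_image.1 hb₀
    have e : a + b - ((a₀' : G) + b₀') =
        ((⟨a, memX ha⟩ + ⟨b, memY hb⟩ - (a₀' + b₀') : ↥H') : G) := rfl
    rw [e, mem_map_subtype_iff] at hq
    obtain ⟨h1, h2⟩ := h.quot_unique ⟨a, memX ha⟩ (mem_toSub.2 ha) ⟨b, memY hb⟩ (mem_toSub.2 hb)
      a₀' ha₀' b₀' hb₀' hq
    have e1 : a - (a₀' : G) = ((⟨a, memX ha⟩ - a₀' : ↥H') : G) := rfl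
    have e2 : b - (b₀' : G) = ((⟨b, memY hb⟩ - b₀' : ↥H') : G) := rfl
    rw [e1, e2, mem_map_subtype_iff, mem_map_subtype_iff]
    exact ⟨h1, h2⟩
  · rw [cosetCount_map_subtype (coe_add_subset hX hY), cosetCount_map_subtype hX,
      cosetCount_map_subtype hY, toSub_add hX hY]
    exact h.cosetCount_add
  · have hb := h.bottom
    rw [← toSub_image_val X₀, ← toSub_image_val Y₀] at hb
    rcases hb with hb | hb | hb | hb
    · exact Or.inl (IsTypeV.of_toSub hX₀ hY₀ hb)
    · exact Or.inr (Or.inl (IsTypeVI.of_toSub hX₀ hY₀ hb))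
    · exact Or.inr (Or.inr (Or.inl (IsTypeVII.of_toSub hX₀ hY₀ hb)))
    · exact Or.inr (Or.inr (Or.inr (IsTypeVIII.of_toSub hX₀ hY₀ hb)))

namespace Grynkiewicz2009

/-- (17) descends from `↥H'` to `G` (the holes `α, β ∈ H'` serve in `G`).
[cite: Grynkiewicz2009, Thm 4.1 (display (17)); §6 Claim 4] -/
theorem seventeen_of_toSub {X Y : Finset G} (hX : (X : Set G) ⊆ H') (hY : (Y : Set G) ⊆ H')
    (h : ∃ α β : ↥H', #(insert α (toSub H' X) + insert β (toSub H' Y)) + 1 =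
      #(insert α (toSub H' X)) + #(insert β (toSub H' Y))) :
    ∃ α β : G, #(insert α X + insert β Y) + 1 = #(insert α X) + #(insert β Y) := by
  classical
  obtain ⟨α, β, h⟩ := h
  refine ⟨α, β, ?_⟩
  have hαX := coe_insert_subset hX α
  have hβY := coe_insert_subset hY β
  rw [← toSub_insert, ← toSub_insert, ← toSub_add hαX hβY, card_toSub (coe_add_subset hαX hβY),
    card_toSub hαX, card_toSub hβY] at h
  exact h

/-- **The conclusion of Theorem 4.1 descends from a subgroup**: for `X, Y ⊆ H'`, the conclusion of
Theorem 4.1 (first part) for `(X, Y)` regarded inside `↥H'` gives it for `(X, Y)` in `G`.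
[cite: Grynkiewicz2009, §6 Claim 4 («w.l.o.g. ⟨A⟩ = ⟨B⟩ = G»)] -/
theorem conclusion_of_toSub {X Y : Finset G} (hX : (X : Set G) ⊆ H') (hY : (Y : Set G) ⊆ H')
    (h : (∃ α β : ↥H', #(insert α (toSub H' X) + insert β (toSub H' Y)) + 1 =
        #(insert α (toSub H' X)) + #(insert β (toSub H' Y))) ∨
      ∃ (K : AddSubgroup ↥H') (X₁ X₀ Y₁ Y₀ : Finset ↥H'),
        IsGrynkiewiczDecomp K (toSub H' X) (toSub H' Y) X₁ X₀ Y₁ Y₀) :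
    (∃ α β : G, #(insert α X + insert β Y) + 1 = #(insert α X) + #(insert β Y)) ∨
      ∃ (K : AddSubgroup G) (X₁ X₀ Y₁ Y₀ : Finset G), IsGrynkiewiczDecomp K X Y X₁ X₀ Y₁ Y₀ := by
  classical
  rcases h with h | ⟨K, X₁, X₀, Y₁, Y₀, hK⟩
  · exact Or.inl (seventeen_of_toSub hX hY h)
  · exact Or.inr ⟨_, _, _, _, _, hK.of_toSub hX hY⟩

end Grynkiewicz2009

end Transport

namespace Grynkiewicz2009

/-! ### The reduction of Theorem 4.1 (first part) to its core case -/

/-- `(g + A) + (g' + B) = (g + g') + (A + B)` (a copy of the private lemma of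
`KempermanElementaryPairs.lean`). [cite: Grynkiewicz2009, §2] -/
private theorem vadd_add_vadd_eq'' (A B : Finset G) (g g' : G) :
    (g +ᵥ A) + (g' +ᵥ B) = (g + g') +ᵥ (A + B) := by
  rw [vadd_add_assoc, add_comm A (g' +ᵥ B), vadd_add_assoc, vadd_vadd, add_comm B A]

/-- `d⊆(Z, 𝒫) ≥ k` is translation invariant. [cite: Grynkiewicz2009, §2; §6 («w.l.o.g. 0 ∈ A ∩ B»)] -/
theorem forall_card_sdiff_vadd {Z : Finset G} (g : G) {k : ℕ}
    (h : ∀ P : Finset G, Z ⊆ P → P.addStab ≠ {0} → k ≤ #(P \ Z)) :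
    ∀ P : Finset G, g +ᵥ Z ⊆ P → P.addStab ≠ {0} → k ≤ #(P \ (g +ᵥ Z)) := by
  intro P hP hper
  have h1 : Z ⊆ (-g) +ᵥ P := by
    have := vadd_finset_subset_vadd_finset (a := -g) hP
    rwa [neg_vadd_vadd] at this
  have := h _ h1 (by rwa [addStab_vadd])
  rwa [show ((-g) +ᵥ P) \ Z = (-g) +ᵥ (P \ (g +ᵥ Z)) by rw [vadd_finset_sdiff, neg_vadd_vadd],
    card_vadd_finset] at this

/-- **Claims 2 and 3, «w.l.o.g. `0 ∈ A ∩ B`», on top of Claim 4's first half.**  If the conclusion of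
Theorem 4.1 (first part) holds for every pair `A, B ⊆ G` with `0 ∈ A ∩ B`, `|A|, |B| ≥ 3`,
`|A + B| = |A| + |B|`, `A + B` aperiodic, `d⊆(A + B, 𝒫) ≥ 2`, `(A, B)` non-extendible and `A`, `B` not
quasi-periodic, then it holds for every pair of nonempty finite sets with `|A + B| = |A| + |B|` and
`A + B` aperiodic.  (Claim 2: `d⊆(A + B, 𝒫) ≤ 1` gives (17) by `seventeen_of_addStab_insert_ne`, the
value `0` being excluded by aperiodicity; Claim 3: `|A| = 1` contradicts `|A + B| = |A| + |B|` and
`|A| = 2` is type (V) with group `G`, `isGrynkiewiczDecomp_top_of_card_eq_two`; then translate by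
`−a`, `−b` and come back with `seventeen_of_vadd` / `exists_isGrynkiewiczDecomp_of_vadd`.)
[cite: Grynkiewicz2009, §6 (proof of Thm 4.1: first lines, Claims 2–4, pp. 23–24)] -/
theorem conclusion_of_core₀
    (core₀ : ∀ A B : Finset G, (0 : G) ∈ A → (0 : G) ∈ B → 3 ≤ #A → 3 ≤ #B →
      #(A + B) = #A + #B → (A + B).addStab = {0} →
      (∀ P : Finset G, A + B ⊆ P → P.addStab ≠ {0} → 2 ≤ #(P \ (A + B))) →
      IsNonExtendible A B → IsNonExtendible B A → ¬ IsQuasiPeriodic A → ¬ IsQuasiPeriodic B →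
      ((∃ α β : G, #(insert α A + insert β B) + 1 = #(insert α A) + #(insert β B)) ∨
        ∃ (K : AddSubgroup G) (A₁ A₀ B₁ B₀ : Finset G), IsGrynkiewiczDecomp K A B A₁ A₀ B₁ B₀))
    {A B : Finset G} (hA : A.Nonempty) (hB : B.Nonempty) (hAB : #(A + B) = #A + #B)
    (haper : (A + B).addStab = {0}) :
    (∃ α β : G, #(insert α A + insert β B) + 1 = #(insert α A) + #(insert β B)) ∨
      ∃ (K : AddSubgroup G) (A₁ A₀ B₁ B₀ : Finset G), IsGrynkiewiczDecomp K A B A₁ A₀ B₁ B₀ := by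
  classical
  refine conclusion_of_forall_not_isQuasiPeriodic ?_ hA hB hAB haper
  intro A B hA hB hAB haper hneA hneB hAqp hBqp
  -- Claim 2: `d⊆(A + B, 𝒫) ≥ 2`, else (17)
  by_cases hP2 : ∀ P : Finset G, A + B ⊆ P → P.addStab ≠ {0} → 2 ≤ #(P \ (A + B))
  swap
  · push Not at hP2
    obtain ⟨P, hsub, hper, hlt⟩ := hP2
    rcases Nat.lt_or_ge 0 #(P \ (A + B)) with hpos | hzero
    · have h1 : #(P \ (A + B)) = 1 := by omega
      obtain ⟨γ, hγ⟩ := card_eq_one.1 h1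
      have hγmem : γ ∈ P \ (A + B) := by rw [hγ]; exact mem_singleton_self _
      rw [mem_sdiff] at hγmem
      have hP : P = insert γ (A + B) := by
        rw [insert_eq, ← hγ, sdiff_union_of_subset hsub]
      refine Or.inl (seventeen_of_addStab_insert_ne hγmem.2 hAB ?_)
      rw [← hP]; exact hper
    · have h0 : P \ (A + B) = ∅ := card_eq_zero.1 (by omega)
      have hP : P = A + B := Subset.antisymm (sdiff_eq_empty_iff_subset.1 h0) hsub
      rw [hP] at hper
      exact absurd haper hper
  -- Claim 3: `|A|, |B| ≥ 3`
  have hBA : #(B + A) = #B + #A := by rw [add_comm, hAB, add_comm]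
  have h2A : 2 ≤ #A := two_le_card_right hA hBA
  have h2B : 2 ≤ #B := two_le_card_right hB hAB
  have hG : (⊤ : AddSubgroup G) ≠ ⊥ := by
    intro h
    have hx : ∀ x : G, x = 0 := fun x => by
      have hx : x ∈ (⊤ : AddSubgroup G) := AddSubgroup.mem_top x
      rw [h] at hx
      exact AddSubgroup.mem_bot.1 hx
    have hsub : A ⊆ {0} := fun x _ => mem_singleton.2 (hx x)
    have := card_le_card hsub
    rw [card_singleton] at this
    omega
  by_cases hA2 : #A = 2
  · exact Or.inr ⟨⊤, ∅, A, ∅, B, isGrynkiewiczDecomp_top_of_card_eq_two hG hA2 hAB⟩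
  by_cases hB2 : #B = 2
  · exact Or.inr ⟨⊤, ∅, A, ∅, B, isGrynkiewiczDecomp_top_of_card_eq_two' hG hB2 hAB⟩
  have hA3 : 3 ≤ #A := by omega
  have hB3 : 3 ≤ #B := by omega
  -- «We may assume w.l.o.g. that `0 ∈ A ∩ B`»
  obtain ⟨a, ha⟩ := hA
  obtain ⟨b, hb⟩ := hB
  have hsum : ((-a) +ᵥ A) + ((-b) +ᵥ B) = (-a + -b) +ᵥ (A + B) := vadd_add_vadd_eq'' A B _ _
  have h0A : (0 : G) ∈ (-a) +ᵥ A := mem_vadd_finset.2 ⟨a, ha, by simp⟩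
  have h0B : (0 : G) ∈ (-b) +ᵥ B := mem_vadd_finset.2 ⟨b, hb, by simp⟩
  have hAB' : #(((-a) +ᵥ A) + ((-b) +ᵥ B)) = #((-a) +ᵥ A) + #((-b) +ᵥ B) := by
    rw [hsum, card_vadd_finset, card_vadd_finset, card_vadd_finset, hAB]
  have haper' : (((-a) +ᵥ A) + ((-b) +ᵥ B)).addStab = {0} := by
    rw [hsum, addStab_vadd]; exact haper
  have hP2' : ∀ P : Finset G, ((-a) +ᵥ A) + ((-b) +ᵥ B) ⊆ P → P.addStab ≠ {0} →
      2 ≤ #(P \ (((-a) +ᵥ A) + ((-b) +ᵥ B))) := by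
    rw [hsum]; exact forall_card_sdiff_vadd _ hP2
  have h := core₀ ((-a) +ᵥ A) ((-b) +ᵥ B) h0A h0B (by rw [card_vadd_finset]; exact hA3)
    (by rw [card_vadd_finset]; exact hB3) hAB' haper' hP2'
    ((hneA.vadd_left (-a)).vadd_right (-b)) ((hneB.vadd_left (-b)).vadd_right (-a))
    (fun h => hAqp ((isQuasiPeriodic_vadd_iff _).1 h)) (fun h => hBqp ((isQuasiPeriodic_vadd_iff _).1 h))
  rcases h with h17 | hdec
  · exact Or.inl (seventeen_of_vadd h17)
  · exact Or.inr (exists_isGrynkiewiczDecomp_of_vadd hdec)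

/-- **Theorem 4.1 (first part) reduces to its core case (§6, Claims 2–4).**  Suppose that for every
subgroup `G' ≤ G` and every pair `A, B` of finite subsets of `G'` (finsets of `↥G'`) with
`0 ∈ A ∩ B`, `|A|, |B| ≥ 3`, `|A + B| = |A| + |B|`, `A + B` aperiodic, `d⊆(A + B, 𝒫) ≥ 2`, `(A, B)`
non-extendible, `A` and `B` not quasi-periodic and `⟨A⟩ = ⟨B⟩ = G'`, the conclusion of Theorem 4.1
holds: (17), or a decomposition (i)–(iii).  Then the conclusion holds for every pair of nonempty finite
`A, B ⊆ G` with `|A + B| = |A| + |B|` and `A + B` aperiodic.  Proof: `conclusion_of_core₀`, Lemma 5.2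
(`closure_eq_closure_of_not_isQuasiPeriodic`: `⟨A⟩ = ⟨B⟩`), and the passage to `G' = ⟨A⟩`: the
hypotheses lift to `↥G'` (`isNonExtendible_toSub`, `addStab_toSub_eq_singleton`,
`forall_card_sdiff_toSub`, `isQuasiPeriodic_of_toSub`, `closure_toSub_eq_top`) and the conclusion
descends (`conclusion_of_toSub`). [cite: Grynkiewicz2009, §6 Claim 4 (proof of Thm 4.1, p. 24)] -/
theorem conclusion_of_core
    (core : ∀ (G' : AddSubgroup G) (A B : Finset ↥G'), (0 : ↥G') ∈ A → (0 : ↥G') ∈ B →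
      3 ≤ #A → 3 ≤ #B → #(A + B) = #A + #B → (A + B).addStab = {0} →
      (∀ P : Finset ↥G', A + B ⊆ P → P.addStab ≠ {0} → 2 ≤ #(P \ (A + B))) →
      IsNonExtendible A B → IsNonExtendible B A → ¬ IsQuasiPeriodic A → ¬ IsQuasiPeriodic B →
      AddSubgroup.closure (A : Set ↥G') = ⊤ → AddSubgroup.closure (B : Set ↥G') = ⊤ →
      ((∃ α β : ↥G', #(insert α A + insert β B) + 1 = #(insert α A) + #(insert β B)) ∨
        ∃ (K : AddSubgroup ↥G') (A₁ A₀ B₁ B₀ : Finset ↥G'), IsGrynkiewiczDecomp K A B A₁ A₀ B₁ B₀))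
    {A B : Finset G} (hA : A.Nonempty) (hB : B.Nonempty) (hAB : #(A + B) = #A + #B)
    (haper : (A + B).addStab = {0}) :
    (∃ α β : G, #(insert α A + insert β B) + 1 = #(insert α A) + #(insert β B)) ∨
      ∃ (K : AddSubgroup G) (A₁ A₀ B₁ B₀ : Finset G), IsGrynkiewiczDecomp K A B A₁ A₀ B₁ B₀ := by
  classical
  refine conclusion_of_core₀ ?_ hA hB hAB haper
  intro A B h0A h0B hA3 hB3 hAB haper hP2 hneA hneB hAqp hBqp
  -- Lemma 5.2: `⟨A⟩ = ⟨B⟩`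
  have hcl : AddSubgroup.closure (A : Set G) = AddSubgroup.closure (B : Set G) :=
    closure_eq_closure_of_not_isQuasiPeriodic hA3 hB3 h0A h0B hAB haper hneA hneB hAqp hBqp
  have hAG : (A : Set G) ⊆ AddSubgroup.closure (A : Set G) := AddSubgroup.subset_closure
  have hBG : (B : Set G) ⊆ AddSubgroup.closure (A : Set G) := by
    rw [hcl]; exact AddSubgroup.subset_closure
  have hAne : A.Nonempty := ⟨0, h0A⟩
  have hBne : B.Nonempty := ⟨0, h0B⟩
  have hABG := coe_add_subset hAG hBG
  -- the pair regarded inside `G' = ⟨A⟩`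
  have h0A' : (0 : ↥(AddSubgroup.closure (A : Set G))) ∈ toSub _ A := mem_toSub.2 h0A
  have h0B' : (0 : ↥(AddSubgroup.closure (A : Set G))) ∈ toSub _ B := mem_toSub.2 h0B
  have h := core (AddSubgroup.closure (A : Set G)) (toSub _ A) (toSub _ B) h0A' h0B'
    (by rw [card_toSub hAG]; exact hA3) (by rw [card_toSub hBG]; exact hB3)
    (by rw [← toSub_add hAG hBG, card_toSub hABG, card_toSub hAG, card_toSub hBG]; exact hAB)
    (by rw [← toSub_add hAG hBG]; exact addStab_toSub_eq_singleton hABG (hAne.add hBne) haper)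
    (by rw [← toSub_add hAG hBG]; exact forall_card_sdiff_toSub hABG (hAne.add hBne) hP2)
    (isNonExtendible_toSub hAG hBG hneA) (isNonExtendible_toSub hBG hAG hneB)
    (fun h => hAqp (isQuasiPeriodic_of_toSub hAG h)) (fun h => hBqp (isQuasiPeriodic_of_toSub hBG h))
    (closure_toSub_eq_top rfl) (closure_toSub_eq_top hcl.symm)
  exact conclusion_of_toSub hAG hBG h

end Grynkiewicz2009

end Literature.Combinatorics.Additive
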